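import Summits.QuantumFields.YangMills.Theorems.UnitScaleTiltProp7CovLinAvgStructureStep
import Literature.MathematicalPhysics.QuantumFieldTheory.Balaban1983to89.B10StarCount
import HarnessLib

/-!
# Route `UnitScaleTilt`, crux K1 «MinimiserStabilityRegPr» (stmt-QuantumFields-19200), route-R [RP] curved, the curved N6 row (R-C), first brick —
# THE COMB-TRANSPORTED COVARIANT STRAIGHT-LINE MEAN `LINE_V` IS LINEAR, A WEIGHTED `ℓ¹` AVERAGE OF WEIGHT `L^{−d}` OVER THE `L^{d+1}` LINE BONDS,
# AND AN `ℓ²`-CONTRACTION BY `L^{2−d}`: `Σ_c ‖LINE_VZ(c)‖² ≤ L^{2−d}·Σ_b ‖Z(b)‖²` (`= L⁻¹` at d = 3), uniformly in the level and in the background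

Cell `ym3-torus`, width seat `ym-ust-20520-w2` (g3); sequel of ✓ p606243 `…TrueLinReducedStep` (`G_{j+1} = LINE_j(G_j) + D_j`, `‖D_j(c)‖ ≤ 159·α_j·m_j(c)`) and
✓ p606268 `…TrueLinIterStructure`.  THEOREMS ONLY (0 `def`, 0 `sorry`); `--supports stmt-QuantumFields-19200`, count-neutral.  YM₃ on T³ is a ladder rung (R3),
not the Clay problem; nothing here claims the curved N6 bounds, S2, P, the crux or the gap.

WHY (row (R-C) of `CURVED-N6-LOCATED-w2g2.md`, the `ℓ²` bookkeeping).  The consumer ✓ p601741 needs `Σ_c E_c² ≤ c_E·ℓ⁵ε²Σ_b‖Y_b‖²`, an `ℓ²` defect; the reduced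
iterate `G_k` differs from the pure `LINE`-iterate `S^{(k)}Y` by `Σ_j LINE_{k−1}∘⋯∘LINE_{j+1}(D_j)`, so the `ℓ² → ℓ²` norm of `LINE_j` per level decides k-uniformity.
It is EXACTLY `L^{(2−d)/2}` (attained on constant fields): pointwise `‖LINE_VZ(c)‖ ≤ L^{−d}Σ_rΣ_{t<L}‖Z(x_r + te_μ, μ)‖` (transports are isometries; the two
permutation indices are idle), Cauchy–Schwarz over the `L^{d+1}` pairs `(r,t)`, and the reparametrisation `(c, r, t) ↦ (x_r + te_μ, μ)` which is `L`-to-one onto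
the level-`j` bonds (block decomposition `Site.blockEquiv` + translation invariance `B10StarCount.shiftEquiv`).  At d = 3 the factor `L⁻¹ < 1` per level is what
makes the propagated defects sum to `O(ε²·L^{1−k})·Σ‖Y‖²` (next brick).

WHAT IS PROVED (ns `…Theorems.Prop7TrueLinLineBound`; `LINE_V` written out as in ✓ p606243).
* §1 `mass_walk_replicate_true` — the walk mass of the straight segment is `Σ_{t<m}‖Z(shift^t x, μ)‖`; `line_sub` — `LINE_V(Z − Z′) = LINE_VZ − LINE_VZ′`.
* §2 ★ `norm_line_le` — `‖LINE_VZ(c)‖ ≤ (L^d)⁻¹·Σ_rΣ_{t<L}‖Z⟨shift^t(blockSite c₋ r), μ_c⟩‖`.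
* §3 `sum_site_eq_sum_blockSite`, `sum_shift_iterate`, `sum_coarse_offsets_shifts` — `Σ_cΣ_rΣ_{t<L} g⟨shift^t(blockSite c₋ r), μ_c⟩ = L·Σ_b g(b)`.
* §4 ★★ `sum_normSq_line_le` — `Σ_c‖LINE_VZ(c)‖² ≤ (L^d)⁻¹·L²·Σ_b‖Z(b)‖²` (`k + 1 ≤ m + K` standing range).
HONEST SCOPE.  One level, any unitary-type `SU(N)` background (only isometry of the transports is used); no curvature enters here.

References: T. Bałaban, CMP 95 (1984) 17–40 [Balaban1984PropagatorsI] ((1.11), (1.18) pp.19–20); CMP 98 (1985) 17–51 [Balaban1985Averaging] ((5) p.18, (125) p.36).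
-/

noncomputable section

open scoped BigOperators Matrix.Norms.L2Operator

namespace Summit.QuantumFields.YangMills.Theorems.Prop7TrueLinLineBound

open Literature.MathematicalPhysics.QuantumFieldTheory.Balaban1983to89
open Finset T4Continuum BlockAveraging AveragingRT ExpMeanLog BlockAveragingEMLLinearised BlockAveragingEMLLinearisedBackground BlockAveragingEMLProp2
open Summit.QuantumFields.YangMills.Theorems.Prop7HolRatioPerStep (norm_coe_eq_one norm_star_coe_eq_one norm_covWalkSum_le_mass)
open B10StarCount (sum_pbond shiftEquiv)

variable {P : Params} {n : Type*} [Fintype n] [DecidableEq n] [Nonempty n] {j : ℕ}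

/-! ## §1 The straight-segment walk mass and linearity of `LINE_V` -/

omit [Nonempty n] in
/-- The walk mass of a straight segment of `m` forward steps from `x` in direction `μ` is `Σ_{t<m} ‖Z(x + te_μ, μ)‖`. [folklore] -/
theorem mass_walk_replicate_true (Z : PBond P j → Matrix n n ℂ) (μ : Fin P.d) :
    ∀ (m : ℕ) (x : Site P j), ((walk x (List.replicate m (μ, true))).map fun s => ‖Z s.bond‖).sum
      = ∑ t ∈ Finset.range m, ‖Z ⟨(fun z : Site P j => z.shift μ)^[t] x, μ⟩‖
  | 0, x => by simp [walk]
  | m + 1, x => by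
    rw [List.replicate_succ, walk, List.map_cons, List.sum_cons, mass_walk_replicate_true Z μ m (x.shift μ), Finset.sum_range_succ']
    simp only [Function.iterate_succ_apply, Function.iterate_zero_apply]
    rw [add_comm]

/-- `LINE_V` is compatible with differences of bond fields. [cite: Balaban1985Averaging, (125) p.36] -/
theorem line_sub (V : GaugeField P j (Matrix.specialUnitaryGroup n ℂ)) (Z Z' : PBond P j → Matrix n n ℂ) (c : PBond P (j + 1)) :
    ((Fintype.card (Idx P) : ℂ))⁻¹ • ∑ i : Idx P,
        ((holAt V (walk (emb c.src) (stairWord i.2.1 (off i.1))) : Matrix.specialUnitaryGroup n ℂ) : Matrix n n ℂ) *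
          covWalkSum V (Z - Z') (walk (walkEnd (emb c.src) (stairWord i.2.1 (off i.1))) (List.replicate P.L (c.dir, true))) *
        star ((holAt V (walk (emb c.src) (stairWord i.2.1 (off i.1))) : Matrix.specialUnitaryGroup n ℂ) : Matrix n n ℂ)
      = ((Fintype.card (Idx P) : ℂ))⁻¹ • ∑ i : Idx P,
          ((holAt V (walk (emb c.src) (stairWord i.2.1 (off i.1))) : Matrix.specialUnitaryGroup n ℂ) : Matrix n n ℂ) *
            covWalkSum V Z (walk (walkEnd (emb c.src) (stairWord i.2.1 (off i.1))) (List.replicate P.L (c.dir, true))) *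
          star ((holAt V (walk (emb c.src) (stairWord i.2.1 (off i.1))) : Matrix.specialUnitaryGroup n ℂ) : Matrix n n ℂ)
        - ((Fintype.card (Idx P) : ℂ))⁻¹ • ∑ i : Idx P,
          ((holAt V (walk (emb c.src) (stairWord i.2.1 (off i.1))) : Matrix.specialUnitaryGroup n ℂ) : Matrix n n ℂ) *
            covWalkSum V Z' (walk (walkEnd (emb c.src) (stairWord i.2.1 (off i.1))) (List.replicate P.L (c.dir, true))) *
          star ((holAt V (walk (emb c.src) (stairWord i.2.1 (off i.1))) : Matrix.specialUnitaryGroup n ℂ) : Matrix n n ℂ) := by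
  rw [← smul_sub, ← Finset.sum_sub_distrib]
  congr 1
  refine Finset.sum_congr rfl fun i _ => ?_
  rw [sub_eq_add_neg Z Z', covWalkSum_add, ← neg_one_smul ℂ Z', covWalkSum_smul]
  simp only [neg_one_smul, Matrix.mul_add, Matrix.add_mul, Matrix.mul_neg, Matrix.neg_mul]
  abel

/-! ## §2 ★ The pointwise weighted-`ℓ¹` bound -/

/-- ★ **`LINE_V` IS A WEIGHT-`L^{−d}` AVERAGE OVER THE `L^{d+1}` LINE BONDS**: `‖LINE_VZ(c)‖ ≤ (L^d)⁻¹·Σ_rΣ_{t<L}‖Z⟨shift^t(blockSite c₋ r), μ_c⟩‖` — the comb transports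
are isometries, the segment sum is bounded by its walk mass (`norm_covWalkSum_le_mass`), the staircase ends at the block site of record (`walkEnd_emb_stairWord_eq_blockSite`),
and the two permutation indices are idle (`sum_idx_of_fst`, `card_idx`). [cite: Balaban1985Averaging, (125) p.36] -/
theorem norm_line_le (V : GaugeField P j (Matrix.specialUnitaryGroup n ℂ)) (Z : PBond P j → Matrix n n ℂ) (c : PBond P (j + 1)) :
    ‖((Fintype.card (Idx P) : ℂ))⁻¹ • ∑ i : Idx P,
        ((holAt V (walk (emb c.src) (stairWord i.2.1 (off i.1))) : Matrix.specialUnitaryGroup n ℂ) : Matrix n n ℂ) *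
          covWalkSum V Z (walk (walkEnd (emb c.src) (stairWord i.2.1 (off i.1))) (List.replicate P.L (c.dir, true))) *
        star ((holAt V (walk (emb c.src) (stairWord i.2.1 (off i.1))) : Matrix.specialUnitaryGroup n ℂ) : Matrix n n ℂ)‖
      ≤ ((P.L : ℝ) ^ P.d)⁻¹ * ∑ r : Fin P.d → Fin P.L, ∑ t ∈ Finset.range P.L, ‖Z ⟨(fun z : Site P j => z.shift c.dir)^[t] (Site.blockSite c.src r), c.dir⟩‖ := by
  have hI : (0 : ℝ) < (Fintype.card (Idx P) : ℝ) := by exact_mod_cast Fintype.card_pos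
  -- each term is bounded by the straight-segment mass from the block site `x_r`
  have hterm : ∀ i : Idx P,
      ‖((holAt V (walk (emb c.src) (stairWord i.2.1 (off i.1))) : Matrix.specialUnitaryGroup n ℂ) : Matrix n n ℂ) *
          covWalkSum V Z (walk (walkEnd (emb c.src) (stairWord i.2.1 (off i.1))) (List.replicate P.L (c.dir, true))) *
        star ((holAt V (walk (emb c.src) (stairWord i.2.1 (off i.1))) : Matrix.specialUnitaryGroup n ℂ) : Matrix n n ℂ)‖
        ≤ ∑ t ∈ Finset.range P.L, ‖Z ⟨(fun z : Site P j => z.shift c.dir)^[t] (Site.blockSite c.src i.1), c.dir⟩‖ := by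
    intro i
    rw [← mass_walk_replicate_true Z c.dir P.L (Site.blockSite c.src i.1), ← walkEnd_emb_stairWord_eq_blockSite c.src i.2.1 i.1]
    calc _ ≤ ‖((holAt V (walk (emb c.src) (stairWord i.2.1 (off i.1))) : Matrix.specialUnitaryGroup n ℂ) : Matrix n n ℂ)‖ *
            ‖covWalkSum V Z (walk (walkEnd (emb c.src) (stairWord i.2.1 (off i.1))) (List.replicate P.L (c.dir, true)))‖ *
            ‖star ((holAt V (walk (emb c.src) (stairWord i.2.1 (off i.1))) : Matrix.specialUnitaryGroup n ℂ) : Matrix n n ℂ)‖ :=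
          (norm_mul_le _ _).trans (mul_le_mul_of_nonneg_right (norm_mul_le _ _) (norm_nonneg _))
      _ = ‖covWalkSum V Z (walk (walkEnd (emb c.src) (stairWord i.2.1 (off i.1))) (List.replicate P.L (c.dir, true)))‖ := by
          rw [norm_coe_eq_one, norm_star_coe_eq_one, one_mul, mul_one]
      _ ≤ _ := norm_covWalkSum_le_mass V Z _
  -- norm of the mean ≤ mean of the bounds; the permutation indices are idle
  rw [norm_smul, norm_inv, Complex.norm_natCast]
  calc (Fintype.card (Idx P) : ℝ)⁻¹ * ‖∑ i : Idx P,
        ((holAt V (walk (emb c.src) (stairWord i.2.1 (off i.1))) : Matrix.specialUnitaryGroup n ℂ) : Matrix n n ℂ) *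
          covWalkSum V Z (walk (walkEnd (emb c.src) (stairWord i.2.1 (off i.1))) (List.replicate P.L (c.dir, true))) *
        star ((holAt V (walk (emb c.src) (stairWord i.2.1 (off i.1))) : Matrix.specialUnitaryGroup n ℂ) : Matrix n n ℂ)‖
      ≤ (Fintype.card (Idx P) : ℝ)⁻¹ * ∑ i : Idx P, ∑ t ∈ Finset.range P.L, ‖Z ⟨(fun z : Site P j => z.shift c.dir)^[t] (Site.blockSite c.src i.1), c.dir⟩‖ :=
        mul_le_mul_of_nonneg_left ((norm_sum_le _ _).trans (Finset.sum_le_sum fun i _ => hterm i)) (by positivity)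
    _ = ((P.L : ℝ) ^ P.d)⁻¹ * ∑ r : Fin P.d → Fin P.L, ∑ t ∈ Finset.range P.L, ‖Z ⟨(fun z : Site P j => z.shift c.dir)^[t] (Site.blockSite c.src r), c.dir⟩‖ := by
        rw [sum_idx_of_fst (fun r : Fin P.d → Fin P.L => ∑ t ∈ Finset.range P.L, ‖Z ⟨(fun z : Site P j => z.shift c.dir)^[t] (Site.blockSite c.src r), c.dir⟩‖),
          card_idx, nsmul_eq_mul]
        have hS : (0 : ℝ) < (Fintype.card (Equiv.Perm (Fin P.d)) : ℝ) := by exact_mod_cast Fintype.card_pos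
        have hL : (0 : ℝ) < (P.L : ℝ) ^ P.d := by have := P.L_pos; positivity
        push_cast
        field_simp

/-! ## §3 The reparametrisation `(c, r, t) ↦ ⟨shift^t(blockSite c₋ r), μ_c⟩` is `L`-to-one -/

omit [Fintype n] [DecidableEq n] [Nonempty n] in
/-- A sum over the level-`j` torus is the sum over `(j+1)`-blocks of the sums over block offsets (standing range; `Site.blockEquiv`). [folklore] -/
theorem sum_site_eq_sum_blockSite {α : Type*} [AddCommMonoid α] (hj : j + 1 ≤ P.m + P.K) (F : Site P j → α) :
    ∑ x, F x = ∑ y : Site P (j + 1), ∑ r : Fin P.d → Fin P.L, F (Site.blockSite y r) := by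
  rw [← Finset.sum_fiberwise_of_maps_to (s := Finset.univ) (t := Finset.univ) (g := blockOf) (fun _ _ => Finset.mem_univ _) F]
  refine Finset.sum_congr rfl fun y _ => ?_
  have hmem : ∀ x : Site P j, blockOf x = y ↔ x ∈ ({x ∈ Finset.univ | blockOf x = y} : Finset (Site P j)) := fun x => by simp
  let e : (Fin P.d → Fin P.L) ≃ ↥({x ∈ Finset.univ | blockOf x = y} : Finset (Site P j)) :=
    (Site.blockEquiv hj y).symm.trans (Equiv.subtypeEquivRight hmem)
  rw [← Finset.sum_coe_sort _ F, ← Equiv.sum_comp e (fun a => F a.1)]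
  exact Finset.sum_congr rfl fun r _ => rfl

omit [Fintype n] [DecidableEq n] [Nonempty n] in
/-- Translation invariance of torus sums, iterated: `Σ_x g(x + te_μ) = Σ_x g(x)`. [folklore] -/
theorem sum_shift_iterate {α : Type*} [AddCommMonoid α] (μ : Fin P.d) (g : Site P j → α) :
    ∀ t : ℕ, ∑ x : Site P j, g ((fun z : Site P j => z.shift μ)^[t] x) = ∑ x : Site P j, g x
  | 0 => by simp
  | t + 1 => by
    have h := sum_shift_iterate μ (fun x => g (x.shift μ)) t
    simp only [Function.iterate_succ_apply'] at h ⊢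
    rw [show (∑ x : Site P j, g (((fun z : Site P j => z.shift μ)^[t] x).shift μ)) = ∑ x : Site P j, g (x.shift μ) from h]
    exact Equiv.sum_comp (shiftEquiv (P := P) (i := j) μ) g

omit [Fintype n] [DecidableEq n] [Nonempty n] in
/-- **THE LINE REPARAMETRISATION IS `L`-TO-ONE**: `Σ_c Σ_r Σ_{t<L} g⟨shift^t(blockSite c₋ r), μ_c⟩ = L·Σ_b g(b)` (standing range). [cite: Balaban1984PropagatorsI, (1.11) p.19] -/
theorem sum_coarse_offsets_shifts (hj : j + 1 ≤ P.m + P.K) (g : PBond P j → ℝ) :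
    ∑ c : PBond P (j + 1), ∑ r : Fin P.d → Fin P.L, ∑ t ∈ Finset.range P.L, g ⟨(fun z : Site P j => z.shift c.dir)^[t] (Site.blockSite c.src r), c.dir⟩
      = (P.L : ℝ) * ∑ b : PBond P j, g b := by
  rw [sum_pbond (fun c : PBond P (j + 1) => ∑ r : Fin P.d → Fin P.L, ∑ t ∈ Finset.range P.L,
      g ⟨(fun z : Site P j => z.shift c.dir)^[t] (Site.blockSite c.src r), c.dir⟩)]
  -- swap `μ` outside, recombine `(y, r)` into a fine site, swap `t` outside, translate
  calc ∑ y : Site P (j + 1), ∑ μ : Fin P.d, ∑ r : Fin P.d → Fin P.L, ∑ t ∈ Finset.range P.L,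
          g ⟨(fun z : Site P j => z.shift μ)^[t] (Site.blockSite y r), μ⟩
      = ∑ μ : Fin P.d, ∑ x : Site P j, ∑ t ∈ Finset.range P.L, g ⟨(fun z : Site P j => z.shift μ)^[t] x, μ⟩ := by
        rw [Finset.sum_comm]
        refine Finset.sum_congr rfl fun μ _ => ?_
        exact (sum_site_eq_sum_blockSite hj (fun x : Site P j => ∑ t ∈ Finset.range P.L, g ⟨(fun z : Site P j => z.shift μ)^[t] x, μ⟩)).symm
    _ = ∑ μ : Fin P.d, ∑ t ∈ Finset.range P.L, ∑ x : Site P j, g ⟨(fun z : Site P j => z.shift μ)^[t] x, μ⟩ :=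
        Finset.sum_congr rfl fun μ _ => Finset.sum_comm
    _ = ∑ μ : Fin P.d, ∑ _t ∈ Finset.range P.L, ∑ x : Site P j, g ⟨x, μ⟩ := by
        refine Finset.sum_congr rfl fun μ _ => Finset.sum_congr rfl fun t _ => ?_
        exact sum_shift_iterate μ (fun x => g ⟨x, μ⟩) t
    _ = (P.L : ℝ) * ∑ b : PBond P j, g b := by
        simp only [Finset.sum_const, Finset.card_range, nsmul_eq_mul]
        rw [← Finset.mul_sum, sum_pbond g]
        congr 1
        exact Finset.sum_comm

/-! ## §4 ★★ The `ℓ²` contraction of `LINE_V` -/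

/-- ★★ **`Σ_c ‖LINE_VZ(c)‖² ≤ (L^d)⁻¹·L²·Σ_b ‖Z(b)‖²`** (`= L^{2−d}·Σ‖Z‖²`; `L⁻¹` at d = 3), uniformly in the level `j + 1 ≤ m + K` and in the `SU(N)` background `V`:
pointwise weighted-`ℓ¹` bound (§2), Cauchy–Schwarz over the `L^{d+1}` pairs `(r,t)`, and the `L`-to-one reparametrisation (§3).  Sharp on constant fields.
[cite: Balaban1984PropagatorsI, (1.11), (1.18) pp.19-20] -/
theorem sum_normSq_line_le (hj : j + 1 ≤ P.m + P.K) (V : GaugeField P j (Matrix.specialUnitaryGroup n ℂ)) (Z : PBond P j → Matrix n n ℂ) :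
    ∑ c : PBond P (j + 1), ‖((Fintype.card (Idx P) : ℂ))⁻¹ • ∑ i : Idx P,
        ((holAt V (walk (emb c.src) (stairWord i.2.1 (off i.1))) : Matrix.specialUnitaryGroup n ℂ) : Matrix n n ℂ) *
          covWalkSum V Z (walk (walkEnd (emb c.src) (stairWord i.2.1 (off i.1))) (List.replicate P.L (c.dir, true))) *
        star ((holAt V (walk (emb c.src) (stairWord i.2.1 (off i.1))) : Matrix.specialUnitaryGroup n ℂ) : Matrix n n ℂ)‖ ^ 2
      ≤ ((P.L : ℝ) ^ P.d)⁻¹ * (P.L : ℝ) ^ 2 * ∑ b : PBond P j, ‖Z b‖ ^ 2 := by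
  have hLpos : (0 : ℝ) < (P.L : ℝ) := by exact_mod_cast P.L_pos
  have hLd : (0 : ℝ) < (P.L : ℝ) ^ P.d := pow_pos hLpos _
  -- abbreviate the `(r,t)` double sums as sums over the product finset
  set A : PBond P (j + 1) → (Fin P.d → Fin P.L) → ℕ → ℝ :=
    fun c r t => ‖Z ⟨(fun z : Site P j => z.shift c.dir)^[t] (Site.blockSite c.src r), c.dir⟩‖ with hA
  -- Cauchy–Schwarz per coarse bond: `(Σ_{r,t} a)² ≤ (L^d·L)·Σ_{r,t} a²`
  have hCS : ∀ c : PBond P (j + 1),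
      (∑ r : Fin P.d → Fin P.L, ∑ t ∈ Finset.range P.L, A c r t) ^ 2
        ≤ ((P.L : ℝ) ^ P.d * P.L) * ∑ r : Fin P.d → Fin P.L, ∑ t ∈ Finset.range P.L, A c r t ^ 2 := by
    intro c
    have h := sq_sum_le_card_mul_sum_sq (s := (Finset.univ : Finset (Fin P.d → Fin P.L)) ×ˢ Finset.range P.L) (f := fun p => A c p.1 p.2)
    rw [Finset.sum_product, Finset.sum_product, Finset.card_product, Finset.card_univ, Fintype.card_fun, Fintype.card_fin, Fintype.card_fin,
      Finset.card_range] at h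
    push_cast at h
    exact h
  -- pointwise: `‖LINE(c)‖² ≤ (L^d)⁻² (Σ a)² ≤ (L^d)⁻¹·L·Σ a²`
  have hpt : ∀ c : PBond P (j + 1), ‖((Fintype.card (Idx P) : ℂ))⁻¹ • ∑ i : Idx P,
        ((holAt V (walk (emb c.src) (stairWord i.2.1 (off i.1))) : Matrix.specialUnitaryGroup n ℂ) : Matrix n n ℂ) *
          covWalkSum V Z (walk (walkEnd (emb c.src) (stairWord i.2.1 (off i.1))) (List.replicate P.L (c.dir, true))) *
        star ((holAt V (walk (emb c.src) (stairWord i.2.1 (off i.1))) : Matrix.specialUnitaryGroup n ℂ) : Matrix n n ℂ)‖ ^ 2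
      ≤ ((P.L : ℝ) ^ P.d)⁻¹ * P.L * ∑ r : Fin P.d → Fin P.L, ∑ t ∈ Finset.range P.L, A c r t ^ 2 := by
    intro c
    have h1 := norm_line_le V Z c
    have h0 : 0 ≤ ∑ r : Fin P.d → Fin P.L, ∑ t ∈ Finset.range P.L, A c r t :=
      Finset.sum_nonneg fun r _ => Finset.sum_nonneg fun t _ => norm_nonneg _
    calc _ ≤ (((P.L : ℝ) ^ P.d)⁻¹ * ∑ r : Fin P.d → Fin P.L, ∑ t ∈ Finset.range P.L, A c r t) ^ 2 :=
          pow_le_pow_left₀ (norm_nonneg _) h1 2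
      _ = (((P.L : ℝ) ^ P.d)⁻¹) ^ 2 * (∑ r : Fin P.d → Fin P.L, ∑ t ∈ Finset.range P.L, A c r t) ^ 2 := by ring
      _ ≤ (((P.L : ℝ) ^ P.d)⁻¹) ^ 2 * (((P.L : ℝ) ^ P.d * P.L) * ∑ r : Fin P.d → Fin P.L, ∑ t ∈ Finset.range P.L, A c r t ^ 2) :=
          mul_le_mul_of_nonneg_left (hCS c) (by positivity)
      _ = ((P.L : ℝ) ^ P.d)⁻¹ * P.L * ∑ r : Fin P.d → Fin P.L, ∑ t ∈ Finset.range P.L, A c r t ^ 2 := by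
          field_simp
  -- sum over `c` and reparametrise
  calc _ ≤ ∑ c : PBond P (j + 1), ((P.L : ℝ) ^ P.d)⁻¹ * P.L * ∑ r : Fin P.d → Fin P.L, ∑ t ∈ Finset.range P.L, A c r t ^ 2 :=
        Finset.sum_le_sum fun c _ => hpt c
    _ = ((P.L : ℝ) ^ P.d)⁻¹ * P.L * ((P.L : ℝ) * ∑ b : PBond P j, ‖Z b‖ ^ 2) := by
        rw [← Finset.mul_sum, sum_coarse_offsets_shifts hj (fun b : PBond P j => ‖Z b‖ ^ 2)]
    _ = ((P.L : ℝ) ^ P.d)⁻¹ * (P.L : ℝ) ^ 2 * ∑ b : PBond P j, ‖Z b‖ ^ 2 := by ring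

end Summit.QuantumFields.YangMills.Theorems.Prop7TrueLinLineBound

end
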